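import Summits.ValiantsHypothesis.ValiantsHypothesis.Theorems.NewtonUnitEquationsTwoProductsRankOneThreeFreeLawFree
import HarnessLib

/-!
# Route NewtonUnitEquations — crux `TwoProducts` (stmt-ValiantsHypothesis-5906), line `relation_ladder`, rung R7a (three-term
# rank one, GENERAL shape `α = qβ + rγ`, `q, r ≥ 1`): the FREE LIFT with DOUBLE SLICING — `RankOneThreeFreeLaw` — part 2/6 — the slice functions and THE COEFFICIENT THEOREM (T4, first half)

(T4) the slice indicator/letter-count form/rest-product, `gd`, `mainConst`, `mainTerm`, `corr`, the slice functions `Fsl`, per-term evaluation, THE COEFFICIENT THEOREM `coeff_free_logTrunc` (non-exceptional exponents).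

val-idea-8 g3 (ideator; lens decomp), 2026-08-28. Generalises the R6b module (`α = β + γ`, val-lit-p3 g15's port `…RankOneThreeLaw*`,
imported): the substitution `Y_α ↦ Y_β^q Y_γ^r` has fibres `{x + k(e_α − q e_β − r e_γ)}` of letter count `n_k = R + B_k`, `R = Σ_{rest} x_j`,
`B_k = x_β + x_γ − (q+r−1)k ≥ 0`; slicing BOTH relation coordinates `(b₁, b₂) = (x_β, x_γ)` makes `multinomial(L_k)/n_k = Pfac(x) ·
C(R + B_k − 1, B_k) · κ_k` EXACT with `Pfac = (R−1)!/∏_{rest} x_j!`, so the slice functions are R6b's with `(b − k) ↦ B_k` and no binomial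
character — finite SHIFT RANK, and val-lit-p3's `ShiftRank.pencilCount` applies BY NAME.  Large coefficients (`q > m` or `r > m`) force
permutation type (`msetT a e ≤ m`), handled by R3♯ `permTypeLaw_proof`.

PORT NOTE (val-lit-p3 g15, prover seat, helper mode `--supports stmt-ValiantsHypothesis-5906 --as helper`, no stub credit claimed; the
author's invitation val-width INBOX 11:42Z + desk RULING #279 (c)): part 2/6 of a VERBATIM Theorems-side port of val-idea-8 g3's sorry-free
module `Cruxes/TwoProducts/Lines/relation_ladder_R7a.lean` (tree @0a494ab61a34; sha256 2455bfd4f3ef04f6…; 1 627 lines; `lean check` rc 0,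
0 sorries, 0 warnings). ALL mathematics and ALL proofs are val-idea-8 g3's (engine memo `Lines/relation_ladder_R7_engine.md` rev 2 §7).  The
port changes only: (i) the file split and the import chain; (ii) declarations that the source re-declares VERBATIM from the landed R6b port
(`sum_sgn`, `HSD` + `HSD.mul/mulHom/homMul/constMul/sum/add`, `hsd_binChar`, `rW_pos`) or from the R6 port (`tab`, `sgn`, `rW`,
`toolBound_mono`) or from `…FormalLogLinearisationStubRaysRung` (`wt_nsmul'` = `wt_nsmul`) are NOT re-declared but referenced BY NAME
(`R6b.…` for the sibling namespace); (iii) the section variables are renamed `I ↦ Iq` (the `QIdx` datum) and `D ↦ Dq` (the `RelData`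
datum) — a pure α-renaming forced by the gate's statement-text index (`dedup.landed` keys on declaration text, namespace-blind, and
the R6b port owns same-text lemmas over `ThreeIdx`); (iv) one-line docstrings on API lemmas; (v) in part 6/6 the parameter-free
`def RankOneThreeFreeLaw : Prop` is NOT declared (relocation rule) — the law is stated by its LITERAL body as `rankOneThreeFreeLaw_proof`.
Namespace = the author's (`…PermutationType.R7a`).  Nothing here closes the line's residual, the crux `TwoProducts` (5906) or `VP ≠ VNP`;
no summit statement is proved.

Honest scope (the author's): relations with the lone letter carrying a coefficient `p ≥ 2` (e.g. `2β = α + γ` = R6c, `pβ = qα + rγ`), two-letter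
`pα = qβ`, support ≥ 4 and coincidence rank ≥ 2 are NOT covered here.  Nothing here moves VP ≠ VNP; `TwoProducts` (5906) stays OPEN. [folklore]
-/

noncomputable section

-- Sub = Summit single-conjunct layout: the duplicated namespace component is mandated by the tree.
set_option linter.dupNamespace false
set_option linter.unusedSimpArgs false
set_option linter.deprecated false
set_option linter.unusedSectionVars false
set_option linter.unusedVariables false
set_option linter.unnecessarySeqFocus false

namespace Summit.ValiantsHypothesis.ValiantsHypothesis.Theorems.NewtonUnitEquations.TwoProducts.PermutationType
namespace R7a
open scoped BigOperators
open MvPolynomial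

variable {σ : Type*} [Fintype σ] [DecidableEq σ]

variable (Iq : QIdx σ)

/-- Fibre sums of the free substitution: `coeff_x (φ_M H) = Σ_{k ∈ KR x} coeff_{L_k} H` (for `x a = 0`). [folklore] -/
theorem coeff_phiT_frM (H : MvPolynomial σ ℂ) (x : σ →₀ ℕ) (hx : x Iq.a = 0) :
    coeff x (phiT (frM Iq) H) = ∑ k ∈ KR Iq x, coeff (Lof Iq x k) H := by
  classical
  rw [coeff_phiT]
  rw [← Finset.sum_filter_add_sum_filter_not (KR Iq x) (fun k => Lof Iq x k ∈ H.support)]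
  rw [Finset.sum_eq_zero (s := (KR Iq x).filter fun k => ¬ Lof Iq x k ∈ H.support)
    (fun k hk => notMem_support_iff.mp (Finset.mem_filter.mp hk).2), add_zero]
  apply Finset.sum_nbij' (fun L => L Iq.a) (fun k => Lof Iq x k)
  · intro L hL
    rw [Finset.mem_filter] at hL
    obtain ⟨-, hk, hLeq⟩ := eq_Lof_of_piT Iq L x hL.2
    rw [Finset.mem_filter, ← hLeq]
    exact ⟨hk, hL.1⟩
  · intro k hk
    rw [Finset.mem_filter] at hk
    rw [Finset.mem_filter]
    exact ⟨hk.2, piT_Lof Iq x hx k hk.1⟩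
  · intro L hL
    rw [Finset.mem_filter] at hL
    exact (eq_Lof_of_piT Iq L x hL.2).2.2.symm
  · intro k _
    exact Lof_a Iq x k
  · intro L hL
    rw [Finset.mem_filter] at hL
    obtain ⟨-, -, hLeq⟩ := eq_Lof_of_piT Iq L x hL.2
    rw [← hLeq]

/-! ## Part T4: the slice functions `F_{b₁,b₂}` (double slicing) and THE COEFFICIENT THEOREM for the free lift of the truncated
logarithm -/

section Slice
variable {m : ℕ}

/-- The slice indicator `[ν_a = 0] [ν_b = 0] [ν_c = 0]`. [folklore] -/
def ind (ν : σ → ℕ) : ℂ := if ν Iq.a = 0 ∧ ν Iq.b = 0 ∧ ν Iq.c = 0 then 1 else 0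

/-- The ADDITIVE letter-count form `λ(ν) = Σ_{j ∉ {a, b, c}} ν_j`. [folklore] -/
def lam (ν : σ → ℕ) : ℕ := ∑ j ∈ rest Iq, ν j

/-- The exponential factor over the untouched letters. [folklore] -/
def restProd (t : σ → ℂ) (ν : σ → ℕ) : ℂ := ∏ j ∈ rest Iq, t j ^ ν j

/-- The admissibility guard `[q k ≤ b₁] [r k ≤ b₂]`. [folklore] -/
def gd (b₁ b₂ k : ℕ) : ℂ := if Iq.q * k ≤ b₁ ∧ Iq.r * k ≤ b₂ then 1 else 0

/-- The `ν`-independent part of the `(j, k)` term: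
`[admissible] · ± (-1)^{(q+r+1)k} t_{ja}^k t_{jb}^{b₁ - qk} t_{jc}^{b₂ - rk} · κ_k`. [folklore] -/
def mainConst (c d : Fin m → σ → ℂ) (b₁ b₂ : ℕ) (j : Fin m ⊕ Fin m) (k : ℕ) : ℂ :=
  gd Iq b₁ b₂ k * (sgn m j * (-1) ^ ((Iq.q + Iq.r + 1) * k) * tab c d j Iq.a ^ k * tab c d j Iq.b ^ (b₁ - Iq.q * k) *
    tab c d j Iq.c ^ (b₂ - Iq.r * k) * kap Iq b₁ b₂ k)

/-- The `(j, k)` term of the slice function `F_{b₁,b₂}`: `mainConst · ∏_rest t_{je}^{ν_e} · C(λ(ν) + B_k - 1, B_k)`. [folklore] -/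
def mainTerm (c d : Fin m → σ → ℂ) (b₁ b₂ : ℕ) (j : Fin m ⊕ Fin m) (k : ℕ) (ν : σ → ℕ) : ℂ :=
  mainConst Iq c d b₁ b₂ j k *
    (restProd Iq (tab c d j) ν * (((lam Iq ν + (Bk Iq b₁ b₂ k - 1)).choose (Bk Iq b₁ b₂ k) : ℕ) : ℂ))

/-- The correction at the exceptional point `ν = 0` of the slice (the exponent `b₁ e_β + b₂ e_γ`). [folklore] -/
def corr (c d : Fin m → σ → ℂ) (b₁ b₂ : ℕ) (ν : σ → ℕ) : ℂ :=
  if (∀ j, ν j = 0) then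
    ∑ j : Fin m ⊕ Fin m, ∑ k : Fin (b₁ + b₂ + 1), mainConst Iq c d b₁ b₂ j k / ((Bk Iq b₁ b₂ k : ℕ) : ℂ)
  else 0

/-- **The slice function** `F_{b₁,b₂}` of the free lift of the truncated logarithm. [folklore] -/
def Fsl (c d : Fin m → σ → ℂ) (b₁ b₂ : ℕ) (ν : σ → ℕ) : ℂ :=
  ind Iq ν * (∑ j : Fin m ⊕ Fin m, ∑ k : Fin (b₁ + b₂ + 1), mainTerm Iq c d b₁ b₂ j k ν) + corr Iq c d b₁ b₂ ν

/-- `lam_xhat` — technical lemma of the R7a free-lift toolkit (val-idea-8 g3). [folklore] -/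
theorem lam_xhat (x : σ →₀ ℕ) : lam Iq ⇑(xhat Iq x) = deg (xhat Iq x) := by
  rw [deg_xhat]; unfold lam
  exact Finset.sum_congr rfl fun j hj => xhat_rest Iq x j hj

/-- `restProd_xhat` — technical lemma of the R7a free-lift toolkit (val-idea-8 g3). [folklore] -/
theorem restProd_xhat (t : σ → ℂ) (x : σ →₀ ℕ) : restProd Iq t ⇑(xhat Iq x) = ∏ j ∈ rest Iq, t j ^ x j := by
  unfold restProd
  exact Finset.prod_congr rfl fun j hj => by rw [xhat_rest Iq x j hj]

/-- `mom_Lof` — technical lemma of the R7a free-lift toolkit (val-idea-8 g3). [folklore] -/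
theorem mom_Lof (t : σ → ℂ) (x : σ →₀ ℕ) (k : ℕ) :
    mom t (Lof Iq x k) = t Iq.a ^ k * t Iq.b ^ (x Iq.b - Iq.q * k) * t Iq.c ^ (x Iq.c - Iq.r * k) * restProd Iq t ⇑(xhat Iq x) := by
  unfold mom
  rw [prod_three_split Iq, Lof_a, Lof_b, Lof_c, restProd_xhat]
  have hr : ∏ j ∈ rest Iq, t j ^ (Lof Iq x k) j = ∏ j ∈ rest Iq, t j ^ x j := by
    refine Finset.prod_congr rfl fun j hj => ?_
    rw [mem_rest] at hj
    rw [Lof_other Iq x k j hj.1 hj.2.1 hj.2.2]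
  rw [hr]; ring

/-- `ind_xhat` — technical lemma of the R7a free-lift toolkit (val-idea-8 g3). [folklore] -/
theorem ind_xhat (x : σ →₀ ℕ) : ind Iq ⇑(xhat Iq x) = 1 := by
  unfold ind; rw [if_pos ⟨xhat_a Iq x, xhat_b Iq x, xhat_c Iq x⟩]

/-- `corr_xhat` — technical lemma of the R7a free-lift toolkit (val-idea-8 g3). [folklore] -/
theorem corr_xhat (c d : Fin m → σ → ℂ) (b₁ b₂ : ℕ) (x : σ →₀ ℕ) (h1 : 1 ≤ deg (xhat Iq x)) :
    corr Iq c d b₁ b₂ ⇑(xhat Iq x) = 0 := by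
  unfold corr
  rw [if_neg]
  intro h
  have : xhat Iq x = 0 := by ext j; exact h j
  rw [this] at h1
  simp [deg] at h1

/-- `choose_bridge` — technical lemma of the R7a free-lift toolkit (val-idea-8 g3). [folklore] -/
theorem choose_bridge (Dq B : ℕ) (h1 : 1 ≤ Dq) : (Dq + (B - 1)).choose B = (Dq + B - 1).choose B := by
  rcases Nat.eq_zero_or_pos B with hB | hB
  · subst hB; simp
  · congr 1; omega

/-- `gd_pos` — technical lemma of the R7a free-lift toolkit (val-idea-8 g3). [folklore] -/
theorem gd_pos {b₁ b₂ k : ℕ} (h : Iq.q * k ≤ b₁ ∧ Iq.r * k ≤ b₂) : gd Iq b₁ b₂ k = 1 := by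
  unfold gd; rw [if_pos h]

/-- `gd_neg` — technical lemma of the R7a free-lift toolkit (val-idea-8 g3). [folklore] -/
theorem gd_neg {b₁ b₂ k : ℕ} (h : ¬ (Iq.q * k ≤ b₁ ∧ Iq.r * k ≤ b₂)) : gd Iq b₁ b₂ k = 0 := by
  unfold gd; rw [if_neg h]

/-- `mainConst_eq_zero` — technical lemma of the R7a free-lift toolkit (val-idea-8 g3). [folklore] -/
theorem mainConst_eq_zero (c d : Fin m → σ → ℂ) {b₁ b₂ k : ℕ} (h : ¬ (Iq.q * k ≤ b₁ ∧ Iq.r * k ≤ b₂)) (j : Fin m ⊕ Fin m) :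
    mainConst Iq c d b₁ b₂ j k = 0 := by
  unfold mainConst; rw [gd_neg Iq h, zero_mul]

/-- The signed atom sum of the constants: `Σ_j mainConst_{jk} = [adm] (-1)^{(q+r+1)k} κ_k (Σ_j mom c_j L_k − Σ_j mom d_j L_k) /
restProd`-free version at a reduced point. [folklore] -/
theorem sum_mainTerm_xhat (c d : Fin m → σ → ℂ) (x : σ →₀ ℕ) (h1 : 1 ≤ deg (xhat Iq x)) (k : ℕ) (hk : k ∈ KR Iq x) :
    ∑ j, mainTerm Iq c d (x Iq.b) (x Iq.c) j k ⇑(xhat Iq x) =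
      (-1 : ℂ) ^ ((Iq.q + Iq.r + 1) * k) *
        (((deg (xhat Iq x) + Bk Iq (x Iq.b) (x Iq.c) k - 1).choose (Bk Iq (x Iq.b) (x Iq.c) k) : ℕ) : ℂ) *
          kap Iq (x Iq.b) (x Iq.c) k * (∑ j, mom (c j) (Lof Iq x k) - ∑ j, mom (d j) (Lof Iq x k)) := by
  have hk' := (mem_KR Iq x k).1 hk
  rw [Fintype.sum_sum_type]
  simp only [mainTerm, mainConst, gd_pos Iq hk', tab, sgn, Sum.elim_inl, Sum.elim_inr, lam_xhat,
    choose_bridge _ _ h1, mom_Lof Iq _ x k]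
  rw [mul_sub, Finset.mul_sum, Finset.mul_sum, sub_eq_add_neg, ← Finset.sum_neg_distrib]
  congr 1
  · exact Finset.sum_congr rfl fun j _ => by ring
  · exact Finset.sum_congr rfl fun j _ => by ring

/-- `sum_mainTerm_xhat_zero` — technical lemma of the R7a free-lift toolkit (val-idea-8 g3). [folklore] -/
theorem sum_mainTerm_xhat_zero (c d : Fin m → σ → ℂ) (x : σ →₀ ℕ) (k : ℕ) (hk : ¬ (Iq.q * k ≤ x Iq.b ∧ Iq.r * k ≤ x Iq.c)) :
    ∑ j, mainTerm Iq c d (x Iq.b) (x Iq.c) j k ⇑(xhat Iq x) = 0 := by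
  refine Finset.sum_eq_zero fun j _ => ?_
  unfold mainTerm; rw [mainConst_eq_zero Iq c d hk j, zero_mul]

/-- The slice function at a reduced point is the fibre sum. [folklore] -/
theorem Fsl_xhat_eq (c d : Fin m → σ → ℂ) (x : σ →₀ ℕ) (h1 : 1 ≤ deg (xhat Iq x)) :
    Fsl Iq c d (x Iq.b) (x Iq.c) ⇑(xhat Iq x) = ∑ k ∈ KR Iq x, (-1 : ℂ) ^ ((Iq.q + Iq.r + 1) * k) *
        (((deg (xhat Iq x) + Bk Iq (x Iq.b) (x Iq.c) k - 1).choose (Bk Iq (x Iq.b) (x Iq.c) k) : ℕ) : ℂ) *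
          kap Iq (x Iq.b) (x Iq.c) k * (∑ j, mom (c j) (Lof Iq x k) - ∑ j, mom (d j) (Lof Iq x k)) := by
  unfold Fsl
  rw [ind_xhat, corr_xhat Iq c d _ _ x h1, one_mul, add_zero, Finset.sum_comm]
  rw [Fin.sum_univ_eq_sum_range (fun k => ∑ j, mainTerm Iq c d (x Iq.b) (x Iq.c) j k ⇑(xhat Iq x)) (x Iq.b + x Iq.c + 1)]
  unfold KR
  rw [Finset.sum_filter]
  refine Finset.sum_congr rfl fun k _ => ?_
  by_cases hk : Iq.q * k ≤ x Iq.b ∧ Iq.r * k ≤ x Iq.c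
  · rw [if_pos hk]
    exact sum_mainTerm_xhat Iq c d x h1 k ((mem_KR Iq x k).2 hk)
  · rw [if_neg hk]
    exact sum_mainTerm_xhat_zero Iq c d x k hk

/-- `qr_mul` — technical lemma of the R7a free-lift toolkit (val-idea-8 g3). [folklore] -/
theorem qr_mul (k : ℕ) : (Iq.q + Iq.r + 1) * k = Iq.q * k + Iq.r * k + k := by ring

/-- **THE COEFFICIENT THEOREM** (double slicing). For `x` with `x_a = 0`, `R = deg x̂ ≥ 1` and `deg x ≤ R_t`:
`coeff_x φ_frM(Λ_{R_t}) = (-1)^{deg x + 1} · Pfac(x) · F_{x_b, x_c}(x̂)`. [folklore] -/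
theorem coeff_free_logTrunc (c d : Fin m → σ → ℂ) (R : ℕ) (x : σ →₀ ℕ) (hx : x Iq.a = 0)
    (h1 : 1 ≤ deg (xhat Iq x)) (hR : deg x ≤ R) :
    coeff x (phiT (frM Iq) (logTrunc c d R)) =
      (-1 : ℂ) ^ (deg x + 1) * Pfac Iq x * Fsl Iq c d (x Iq.b) (x Iq.c) ⇑(xhat Iq x) := by
  classical
  rw [coeff_phiT_frM Iq _ x hx]
  have hdx : deg x = deg (xhat Iq x) + (x Iq.b + x Iq.c) := by rw [deg_eq_deg_xhat_add Iq x, hx, zero_add]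
  have step2 : ∀ k ∈ KR Iq x, coeff (Lof Iq x k) (logTrunc c d R) =
      (-1 : ℂ) ^ (deg x + 1) * Pfac Iq x * ((-1 : ℂ) ^ ((Iq.q + Iq.r + 1) * k) *
        (((deg (xhat Iq x) + Bk Iq (x Iq.b) (x Iq.c) k - 1).choose (Bk Iq (x Iq.b) (x Iq.c) k) : ℕ) : ℂ) *
          kap Iq (x Iq.b) (x Iq.c) k * (∑ j, mom (c j) (Lof Iq x k) - ∑ j, mom (d j) (Lof Iq x k))) := by
    intro k hk
    have hk' := (mem_KR Iq x k).1 hk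
    have hdeg := deg_Lof Iq x k hk
    have hq := le_qmul Iq k
    have hdeg1 : 1 ≤ deg (Lof Iq x k) := by omega
    have hdegR : deg (Lof Iq x k) ≤ R := by omega
    rw [coeff_logTrunc c d R _ hdeg1 hdegR, multinomial_Lof_eq Iq x k hk h1]
    have hsign : (-1 : ℂ) ^ (deg (Lof Iq x k) + 1) = (-1) ^ (deg x + 1) * (-1) ^ ((Iq.q + Iq.r + 1) * k) := by
      have e : deg x + 1 + (Iq.q + Iq.r + 1) * k = (deg (Lof Iq x k) + 1) + 2 * (Iq.q * k + Iq.r * k) := by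
        rw [qr_mul]; omega
      rw [← pow_add, e, pow_add (-1 : ℂ) (deg (Lof Iq x k) + 1), pow_mul]
      norm_num
    have hn0 : ((deg (Lof Iq x k) : ℕ) : ℂ) ≠ 0 := Nat.cast_ne_zero.mpr (by omega)
    rw [hsign]
    field_simp
  rw [Finset.sum_congr rfl step2, ← Finset.mul_sum, Fsl_xhat_eq Iq c d x h1]

/-! ### The exceptional point of a slice (`R = 0`, i.e. `x = b₁ e_β + b₂ e_γ`) -/


end Slice

end R7a
end Summit.ValiantsHypothesis.ValiantsHypothesis.Theorems.NewtonUnitEquations.TwoProducts.PermutationType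

end
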